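import Summits.Ventures.CertifiedArithmetic.LowPrec.SRPythagorasNestedFormats
import Summits.Ventures.CertifiedArithmetic.LowPrec.SRPythagorasTwoSided
import Summits.Ventures.CertifiedArithmetic.LowPrec.SRRungR3Exact
import HarnessLib

/-!
# Stochastic rounding in low-precision formats XCVIII — the StochasticA Pythagorean law on windows of
# ANY SIGN in every format; the WHOLE RANGE with `emaxCode − 1` bits and no window hypothesis

HONEST FRAMING: certified error envelopes and provably optimal rounding/accumulation schemes for
low-precision formats under stated cost models; every table by two implementations; no hardware or
vendor claims.

XCV proved the law `E(ŝₙ − sₙ)² ≤ n·G²/4 + (n·2^{-N}·G)²` (every `n`, no saturation) for IEEE P3109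
StochasticA with `N` random bits on ONE-SIGNED windows `0 ≤ lo ≤ hi` of every `Format`, `N ≥` binade
span.  With the reflection of XCVI and the lever windows of XCVII the sign restriction disappears:
* `valueSet_stochasticA_mirror` — NEGATIVE windows `lo ≤ hi ≤ 0`: `N ≥ binadeIdx(−lo) − binadeIdx(−hi)`
  bits ⇒ drift-antitone and the law with `G = 2^{binadeIdx(−lo)}·quantum` (mirror image of XCV);
* `valueSet_stochasticA_twoSided` — windows ACROSS ZERO `lo ≤ 0 ≤ hi`: `N ≥ max(binadeIdx hi,
  binadeIdx(−lo))` bits (binades of the LARGER side, counted from the subnormal binade) ⇒ drift-antitone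
  and the law with `G` = the larger top spacing;
* `valueSet_stochasticA_all` — THE WHOLE RANGE: `NoSat` alone (every StochasticA accumulation that never
  saturates, any signs, any `n`) and `N ≥ emaxCode − 1` bits ⇒ drift-antitone and the law with
  `G = 2^{emaxCode−1}·quantum`, the top spacing of the format (`inWindow_of_noSat`: an unsaturated tree
  lives in `[−maxRat, maxRat]`).  Instances: FP4 `e2m1_all_A2_law` (`[−6, 6]`, TWO bits, `G = 2`),
  E3M2 `e3m2_all_A6_law` (`G = 4`), E2M3 `e2m3_all_A2_law` (`G = 1/2`) — no enumeration; FP8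
  `e4m3_all_A14_law` (`G = 32`), `e5m2_all_A29_law` (`G = 8192`), `binary16_all_A29_law` (`G = 32`).
* Kernel witnesses (`decide`, two summands): ACROSS ZERO — FP4 `e2m1_one_bit_fails_across_zero` (from
  `0` with summands `−31/64, 5` one bit is not drift-antitone, two bits are, and suffice on all of
  `[−6, 6]`), E3M2 `e3m2_two_bits_fail_across_zero` (`1/4; −15/64, −4`) — the sr-seat certificate
  `certs/sr/gen17/nested` found these as the first non-antitone trees of their classes; the
  WHOLE-RANGE thresholds `emaxCode − 1 = 2, 2, 6, 14, 29` of E2M1, E2M3, E3M2, E4M3, E5M2 are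
  ATTAINED — XCIX `SRPythagorasWholeRangeSharp` (kernel witnesses from `0` with `q/2, T + q`).
Scope (honest): no saturation (the NoSat trees of CHM §4); bit counts are those of the antitone route,
sharp on one-signed windows (XCV) — across zero fewer bits may do for a given tree (evidence in the
certificate, not claimed).  References: [ConnollyHighamMary2021, Lemma 4.4]; [ElararEtAl2025,
Thm. 3–4]; [Higham2002ASNA, §2.1]; IEEE P3109; OCP MX v1.0 (E2M1/E3M2/E2M3), OCP FP8 (E4M3/E5M2).
-/

namespace Summit.Ventures.CertifiedArithmetic.LowPrec.SR

open Literature.ComputerArithmetic.ConnollyHighamMary2021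
open Finset

namespace LimitedBits

section Formats

open Literature.ComputerArithmetic.FloatingPoint (Format MiniFloat)
open Literature.ComputerArithmetic.FloatingPoint.MiniFloat (valueSet valueSet_nonempty)

/-- Value sets of binary formats are symmetric (sign flip). -/
theorem valueSet_symm (φ : Format) : ∀ a ∈ valueSet φ, -a ∈ valueSet φ := by
  intro a ha
  obtain ⟨y, rfl⟩ := MiniFloat.mem_valueSet.mp ha
  exact MiniFloat.mem_valueSet.mpr ⟨y.flipSign, MiniFloat.toRat_flipSign y⟩

/-- The binade index of `0` is `0`. -/
theorem binadeIdx_zero (φ : Format) : binadeIdx φ 0 = 0 := by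
  unfold binadeIdx
  rw [zero_div, Int.floor_zero, Int.toNat_zero]
  exact Format.shift_eq_zero_of_lt (by positivity)

/-- `0 ≤ maxRat`. -/
theorem maxRat_nonneg (φ : Format) : (0 : ℚ) ≤ φ.maxRat := by
  have h := MiniFloat.abs_toRat_le_maxRat (MiniFloat.zero φ)
  rwa [MiniFloat.toRat_zero, abs_zero] at h

/-- An unsaturated tree of a format lives in `[−maxRat, maxRat]`: `NoSat` is the only hypothesis the
whole-range law needs. -/
theorem inWindow_of_noSat (φ : Format) :
    ∀ (x : ℕ → ℚ) (n : ℕ) (s : ℚ), NoSat (valueSet φ) x n s →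
      InWindow (valueSet φ) (-φ.maxRat) φ.maxRat x n s := by
  intro x n
  induction n generalizing x with
  | zero => intro s _; trivial
  | succ n ih =>
    rintro s ⟨hin, hnu, hnd⟩
    refine ⟨?_, ih _ _ hnu, ih _ _ hnd⟩
    rw [clamp_eq_self hin]
    obtain ⟨⟨y, hy, hyc⟩, ⟨z, hz, hcz⟩⟩ := hin
    obtain ⟨y', rfl⟩ := MiniFloat.mem_valueSet.mp hy
    obtain ⟨z', rfl⟩ := MiniFloat.mem_valueSet.mp hz
    have h1 := MiniFloat.abs_toRat_le_maxRat y'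
    have h2 := MiniFloat.abs_toRat_le_maxRat z'
    constructor <;> linarith [neg_abs_le y'.toRat, le_abs_self z'.toRat]

/-- **Negative windows, every format (mirror image of XCV).**  For values `lo ≤ hi ≤ 0` of `φ` and
`N ≥ binadeIdx(−lo) − binadeIdx(−hi)` random bits, every StochasticA accumulation confined to `[lo, hi]`
(no saturation) is drift-antitone and satisfies, for every `n`,
`E(ŝₙ − sₙ)² ≤ n·G²/4 + (n·2^{-N}·G)²` with `G = 2^{binadeIdx(−lo)}·quantum`. -/
theorem valueSet_stochasticA_mirror (φ : Format) {lo hi : ℚ} (hlo : lo ∈ valueSet φ)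
    (hhi : hi ∈ valueSet φ) (hhi0 : hi ≤ 0) (hle : lo ≤ hi) {N : ℕ}
    (hN : binadeIdx φ (-lo) ≤ binadeIdx φ (-hi) + N) (x : ℕ → ℚ) (n : ℕ) (s : ℚ)
    (hns : NoSat (valueSet φ) x n s) (hw : InWindow (valueSet φ) lo hi x n s) :
    DriftAntitone (valueSet φ) (probAwayA N) x n s ∧
      accExpQ (valueSet φ) (probAwayA N) x n (fun t => (t - (s + ∑ i ∈ range n, x i)) ^ 2) s
        ≤ n * ((2 ^ binadeIdx φ (-lo) * φ.quantum) ^ 2 / 4)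
          + (n * (1 / 2 ^ N * (2 ^ binadeIdx φ (-lo) * φ.quantum))) ^ 2 := by
  have hW := valueSet_nestedWindow φ (valueSet_symm φ hi hhi) (valueSet_symm φ lo hlo) (by linarith)
  have h := hW.stochasticA_mirror (valueSet_symm φ) (Summit.Ventures.CertifiedArithmetic.zero_mem_valueSet φ) hhi0 (N := N) (by omega)
    x n s hns hw
  have e : (2 : ℚ) ^ (binadeIdx φ (-lo) - binadeIdx φ (-hi)) * (2 ^ binadeIdx φ (-hi) * φ.quantum)
      = 2 ^ binadeIdx φ (-lo) * φ.quantum := by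
    rw [← mul_assoc, ← pow_add, Nat.sub_add_cancel (binadeIdx_mono φ (by linarith))]
  rwa [e] at h

/-- **Windows across zero, every format.**  For values `lo ≤ 0 ≤ hi` of `φ`, `N ≥ binadeIdx hi` and
`N ≥ binadeIdx(−lo)` random bits (the binades of the larger side) and any `G` at least both top
spacings, every StochasticA accumulation confined to `[lo, hi]` (no saturation) is drift-antitone and
`E(ŝₙ − sₙ)² ≤ n·G²/4 + (n·2^{-N}·G)²` for every `n`. -/
theorem valueSet_stochasticA_twoSided (φ : Format) {lo hi : ℚ} (hlo : lo ∈ valueSet φ)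
    (hhi : hi ∈ valueSet φ) (hlo0 : lo ≤ 0) {N : ℕ} (hN : binadeIdx φ hi ≤ N)
    (hN' : binadeIdx φ (-lo) ≤ N) {G : ℚ} (hG : 2 ^ binadeIdx φ hi * φ.quantum ≤ G)
    (hG' : 2 ^ binadeIdx φ (-lo) * φ.quantum ≤ G) (x : ℕ → ℚ) (n : ℕ) (s : ℚ)
    (hns : NoSat (valueSet φ) x n s) (hw : InWindow (valueSet φ) lo hi x n s) :
    DriftAntitone (valueSet φ) (probAwayA N) x n s ∧
      accExpQ (valueSet φ) (probAwayA N) x n (fun t => (t - (s + ∑ i ∈ range n, x i)) ^ 2) s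
        ≤ n * (G ^ 2 / 4) + (n * (1 / 2 ^ N * G)) ^ 2 := by
  have h0 := Summit.Ventures.CertifiedArithmetic.zero_mem_valueSet φ
  have hP := valueSet_nestedWindow φ h0 hhi le_rfl
  have hM := valueSet_nestedWindow φ h0 (valueSet_symm φ lo hlo) le_rfl
  rw [binadeIdx_zero, pow_zero, one_mul, Nat.sub_zero] at hP hM
  have hw' : InWindow (valueSet φ) (-(-lo)) hi x n s := by rw [neg_neg]; exact hw
  exact stochasticA_twoSided (valueSet_symm φ) h0 hP hM (by linarith) hN hN' hG hG' x n s hns hw'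

/-- **THE WHOLE RANGE, every format.**  With `N ≥ emaxCode − 1` random bits, EVERY StochasticA
accumulation that never saturates — any signs, any data, any `n` — is drift-antitone and satisfies
`E(ŝₙ − sₙ)² ≤ n·G²/4 + (n·2^{-N}·G)²` with `G = 2^{emaxCode−1}·quantum`, the top spacing.  No window
hypothesis. -/
theorem valueSet_stochasticA_all (φ : Format) {N : ℕ} (hN : φ.emaxCode - 1 ≤ N) (x : ℕ → ℚ) (n : ℕ)
    (s : ℚ) (hns : NoSat (valueSet φ) x n s) :
    DriftAntitone (valueSet φ) (probAwayA N) x n s ∧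
      accExpQ (valueSet φ) (probAwayA N) x n (fun t => (t - (s + ∑ i ∈ range n, x i)) ^ 2) s
        ≤ n * ((2 ^ (φ.emaxCode - 1) * φ.quantum) ^ 2 / 4)
          + (n * (1 / 2 ^ N * (2 ^ (φ.emaxCode - 1) * φ.quantum))) ^ 2 := by
  have htop : binadeIdx φ φ.maxRat ≤ φ.emaxCode - 1 := Format.shift_le _
  have hmem := MiniFloat.maxRat_mem_valueSet φ
  have hG : (2 : ℚ) ^ binadeIdx φ φ.maxRat * φ.quantum ≤ 2 ^ (φ.emaxCode - 1) * φ.quantum :=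
    mul_le_mul_of_nonneg_right (pow_le_pow_right₀ (by norm_num) htop) φ.quantum_pos.le
  refine valueSet_stochasticA_twoSided φ (valueSet_symm φ _ hmem) hmem
    (by linarith [maxRat_nonneg φ]) (htop.trans hN) ?_ hG ?_ x n s hns (inWindow_of_noSat φ x n s hns)
  · rw [neg_neg]; exact htop.trans hN
  · rw [neg_neg]; exact hG

end Formats

end LimitedBits

namespace Formats

open LimitedBits
open Literature.ComputerArithmetic.FloatingPoint (Format)
open Literature.ComputerArithmetic.FloatingPoint.MiniFloat (valueSet)

/-- **FP4, the whole range `[−6, 6]`, TWO random bits.**  Every StochasticA accumulation in E2M1 that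
never saturates satisfies `E(ŝₙ − sₙ)² ≤ n + (2n/2^N)²` for every `n` (`N ≥ 2`, `G = 2`), and its tree is
drift-antitone. -/
theorem e2m1_all_A2_law {N : ℕ} (hN : 2 ≤ N) (x : ℕ → ℚ) (n : ℕ) (s : ℚ) (hns : NoSat FP4.e2m1 x n s) :
    DriftAntitone FP4.e2m1 (probAwayA N) x n s ∧
      accExpQ FP4.e2m1 (probAwayA N) x n (fun t => (t - (s + ∑ i ∈ range n, x i)) ^ 2) s
        ≤ n * ((2 : ℚ) ^ 2 / 4) + (n * (1 / 2 ^ N * 2)) ^ 2 := by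
  have hq : Format.E2M1.quantum = 1 / 2 := by decide +kernel
  have he : Format.E2M1.emaxCode - 1 = 2 := by decide
  rw [e2m1_eq_valueSet] at hns ⊢
  have h := valueSet_stochasticA_all Format.E2M1 (N := N) (by omega) x n s hns
  rw [he, hq] at h
  exact ⟨h.1, h.2.trans (le_of_eq (by ring))⟩

/-- **FP4: one bit fails ACROSS ZERO, two bits do not** (kernel witness; the certificate's first
non-antitone cross-zero tree).  From `0` with summands `−31/64, 5` the one-bit StochasticA tree is not
drift-antitone; with two bits it is, as `e2m1_all_A2_law` guarantees on all of `[−6, 6]`. -/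
theorem e2m1_one_bit_fails_across_zero :
    InWindow FP4.e2m1 (-6) 6 (seqL [-31 / 64, 5]) 2 0 ∧
      ¬ DriftAntitone FP4.e2m1 (probAwayA 1) (seqL [-31 / 64, 5]) 2 0 ∧
      DriftAntitone FP4.e2m1 (probAwayA 2) (seqL [-31 / 64, 5]) 2 0 := by
  refine ⟨?_, ?_, ?_⟩
  · rw [← inWindowB_iff]; decide +kernel
  · rw [← driftAntitoneB_iff]; decide +kernel
  · rw [← driftAntitoneB_iff]; decide +kernel

/-- **E3M2, the whole range `[−28, 28]`, six random bits** (`G = 4`, the top spacing):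
`E(ŝₙ − sₙ)² ≤ 4n + (4n/2^N)²` for every unsaturated StochasticA accumulation, every `n`, `N ≥ 6`. -/
theorem e3m2_all_A6_law {N : ℕ} (hN : 6 ≤ N) (x : ℕ → ℚ) (n : ℕ) (s : ℚ) (hns : NoSat e3m2 x n s) :
    DriftAntitone e3m2 (probAwayA N) x n s ∧
      accExpQ e3m2 (probAwayA N) x n (fun t => (t - (s + ∑ i ∈ range n, x i)) ^ 2) s
        ≤ n * ((4 : ℚ) ^ 2 / 4) + (n * (1 / 2 ^ N * 4)) ^ 2 := by
  have hq : Format.E3M2.quantum = 1 / 16 := by decide +kernel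
  have he : Format.E3M2.emaxCode - 1 = 6 := by decide
  rw [e3m2_eq_valueSet] at hns ⊢
  have h := valueSet_stochasticA_all Format.E3M2 (N := N) (by omega) x n s hns
  rw [he, hq] at h
  exact ⟨h.1, h.2.trans (le_of_eq (by ring))⟩

/-- **E3M2: two bits fail across zero** (kernel witness; the certificate's first non-antitone cross-zero
tree with two bits).  From `1/4` with summands `−15/64, −4` (window `[−4, 1/4]`) the two-bit tree is not
drift-antitone; the three-bit tree is (for every tree in this window `valueSet_stochasticA_twoSided`
asks for `binadeIdx 4 = 4` bits). -/
theorem e3m2_two_bits_fail_across_zero :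
    InWindow e3m2 (-4) (1 / 4) (seqL [-15 / 64, -4]) 2 (1 / 4) ∧
      ¬ DriftAntitone e3m2 (probAwayA 2) (seqL [-15 / 64, -4]) 2 (1 / 4) ∧
      DriftAntitone e3m2 (probAwayA 3) (seqL [-15 / 64, -4]) 2 (1 / 4) := by
  refine ⟨?_, ?_, ?_⟩
  · rw [← inWindowB_iff]; decide +kernel
  · rw [← driftAntitoneB_iff]; decide +kernel
  · rw [← driftAntitoneB_iff]; decide +kernel

/-- **E2M3, the whole range `[−7.5, 7.5]`, two random bits** (`G = 1/2`). -/
theorem e2m3_all_A2_law {N : ℕ} (hN : 2 ≤ N) (x : ℕ → ℚ) (n : ℕ) (s : ℚ) (hns : NoSat e2m3 x n s) :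
    DriftAntitone e2m3 (probAwayA N) x n s ∧
      accExpQ e2m3 (probAwayA N) x n (fun t => (t - (s + ∑ i ∈ range n, x i)) ^ 2) s
        ≤ n * ((1 / 2 : ℚ) ^ 2 / 4) + (n * (1 / 2 ^ N * (1 / 2))) ^ 2 := by
  have hq : Format.E2M3.quantum = 1 / 8 := by decide +kernel
  have he : Format.E2M3.emaxCode - 1 = 2 := by decide
  rw [e2m3_eq_valueSet] at hns ⊢
  have h := valueSet_stochasticA_all Format.E2M3 (N := N) (by omega) x n s hns
  rw [he, hq] at h
  exact ⟨h.1, h.2.trans (le_of_eq (by ring))⟩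

/-- **FP8 E4M3 (OCP), the whole range `[−448, 448]`, fourteen random bits** (`G = 32`). -/
theorem e4m3_all_A14_law {N : ℕ} (hN : 14 ≤ N) (x : ℕ → ℚ) (n : ℕ) (s : ℚ)
    (hns : NoSat (valueSet Format.E4M3) x n s) :
    DriftAntitone (valueSet Format.E4M3) (probAwayA N) x n s ∧
      accExpQ (valueSet Format.E4M3) (probAwayA N) x n (fun t => (t - (s + ∑ i ∈ range n, x i)) ^ 2) s
        ≤ n * ((32 : ℚ) ^ 2 / 4) + (n * (1 / 2 ^ N * 32)) ^ 2 := by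
  have hq : Format.E4M3.quantum = 1 / 512 := by decide +kernel
  have he : Format.E4M3.emaxCode - 1 = 14 := by decide
  have h := valueSet_stochasticA_all Format.E4M3 (N := N) (by omega) x n s hns
  rw [he, hq] at h
  exact ⟨h.1, h.2.trans (le_of_eq (by ring))⟩

/-- **FP8 E5M2 (OCP), the whole range `[−57344, 57344]`, twenty-nine random bits** (`G = 8192`). -/
theorem e5m2_all_A29_law {N : ℕ} (hN : 29 ≤ N) (x : ℕ → ℚ) (n : ℕ) (s : ℚ)
    (hns : NoSat (valueSet Format.E5M2) x n s) :
    DriftAntitone (valueSet Format.E5M2) (probAwayA N) x n s ∧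
      accExpQ (valueSet Format.E5M2) (probAwayA N) x n (fun t => (t - (s + ∑ i ∈ range n, x i)) ^ 2) s
        ≤ n * ((8192 : ℚ) ^ 2 / 4) + (n * (1 / 2 ^ N * 8192)) ^ 2 := by
  have hq : Format.E5M2.quantum = 1 / 65536 := by decide +kernel
  have he : Format.E5M2.emaxCode - 1 = 29 := by decide
  have h := valueSet_stochasticA_all Format.E5M2 (N := N) (by omega) x n s hns
  rw [he, hq] at h
  exact ⟨h.1, h.2.trans (le_of_eq (by ring))⟩

/-- **binary16, the whole range `[−65504, 65504]`, twenty-nine random bits** (`G = 32`). -/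
theorem binary16_all_A29_law {N : ℕ} (hN : 29 ≤ N) (x : ℕ → ℚ) (n : ℕ) (s : ℚ)
    (hns : NoSat (valueSet Format.Binary16) x n s) :
    DriftAntitone (valueSet Format.Binary16) (probAwayA N) x n s ∧
      accExpQ (valueSet Format.Binary16) (probAwayA N) x n
          (fun t => (t - (s + ∑ i ∈ range n, x i)) ^ 2) s
        ≤ n * ((32 : ℚ) ^ 2 / 4) + (n * (1 / 2 ^ N * 32)) ^ 2 := by
  have hq : Format.Binary16.quantum = 1 / 16777216 := by decide +kernel
  have he : Format.Binary16.emaxCode - 1 = 29 := by decide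
  have h := valueSet_stochasticA_all Format.Binary16 (N := N) (by omega) x n s hns
  rw [he, hq] at h
  exact ⟨h.1, h.2.trans (le_of_eq (by ring))⟩

end Formats

end Summit.Ventures.CertifiedArithmetic.LowPrec.SR
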